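import Summits.NavierStokesRegularity.NavierStokesRegularity.Theorems.ScenarioCensusRowF1IntQuenchCutoff
import Summits.NavierStokesRegularity.NavierStokesRegularity.Theorems.ScenarioCensusRowF1IntStretchBudget
import HarnessLib

/-!
# LINE «integrated-quench» port, part 4/7: §4 (c) — the cut-off enstrophy `Φ` is non-increasing

Re-homed for the scenario census (typer seat ns-census-typer-1 g8; the cell F1iq and the floor DI are MEMBERS OF RECORD «DECIDED IN KERNEL IN FILES» of row F1 since
census v1.76 (critic idea-crit-3 g7 PASS — no price 01:59:11Z; ref ns-census-ref g9 PRE-CHECK ✓ §14.27 item 35; lead-presearch label); this port makes them TREE-decided):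
VERBATIM PORT of ns-idea-3 LINE 22 «integrated-quench», `pub/ideators/ns-idea-3/lines/integrated-quench/line-integrated-quench.lean` sha16 d7402efa28ebc137 (2066 l.,
lean check rc 0, 0 sorry), split for the 400-line rule into seven parts `ScenarioCensusRowF1IntQuench{∅, Kill, Cutoff, Enstrophy, Liouville, Transfer, Top}` (chain
imports).  Lean text VERBATIM in namespace `…Theorems.ScenarioCensus.IntegratedQuench` (the line's `…Cruxes.ScenarioCensusRowF1.IntegratedQuenchLine` re-homed); port
edits: the bracket lines `section IntegralTransfer` / `end IntegralTransfer` dropped (no `variable`s), `@[conjecture]` on the residual `IqSlack` (≡ `ScenarioCensus.Row_F1`,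
OPEN), forty-five one-line docstrings added (gate lint); lemmas the line shares VERBATIM with the landed inviscid-top / frozen-top / columnar-top / stretched-top /
integrated-stretch ports are taken BY NAME (listed below); `norm_laplacian_curl_le` (twin of the tree's `clockAP_norm_laplacian_curl_le`, whose module has no farm build) is
not re-declared and its single use carries the line's own proof as a local `have` (proof text only).  Statements untouched.

No census VALUE is moved here (row F1 stays OPEN-WITH-LINE; the members become TREE-decided by name); NS regularity is NOT proved; `Row_F1` is untouched
(zero movement, `iqSlack_iff_rowF1`); no summit statement is proved by this file. Lemmas that restate already-landed tree declarations are taken BY NAME (gate lint `dedup.landed`): `convect_curl_self` = `FrozenTop.convect_curl_self`, `fderiv_smul_stPull_apply` = `InviscidTop.fderiv_smul_stPull_apply`, `fderiv_smul_stPull` = `InviscidTop.fderiv_smul_stPull`, `fderiv_fderiv_smul_stPull` = `InviscidTop.fderiv_fderiv_smul_stPull`, `tendsto_clm_of_tendsto_apply` = `InviscidTop.tendsto_clm_of_tendsto_apply`, `tendsto_fderiv_fderiv_apply_of_bound` = `InviscidTop.tendsto_fderiv_fderiv_apply_of_bound`, `tendsto_fderiv_fderiv_of_bound` = `InviscidTop.tendsto_fderiv_fderiv_of_bound`,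 `tendsto_fderiv_fderiv_of_typeI_seq_Ioo` = `InviscidTop.tendsto_fderiv_fderiv_of_typeI_seq_Ioo`, `fderiv3_smul_stPull` = `FrozenTop.fderiv3_smul_stPull`, `tendsto_fderiv3_of_typeI_seq_Ioo` = `FrozenTop.tendsto_fderiv3_of_typeI_seq_Ioo`, `tendsto_physicalTime` = `ColumnarTop.tendsto_physicalTime`, `eventually_fast` = `ColumnarTop.eventually_fast`, `sqrt_timeLag` = `StretchedTop.sqrt_timeLag`, `forall_of_forall_ne_zero` = `StretchedTop.forall_of_forall_ne_zero`, `radius_eq` = `FrozenTop.radius_eq`, `jointCond_everywhere₆` = `FrozenTop.jointCond_everywhere₄`, `continuousOn_quad` = `IntegratedStretch.continuousOn_quad`, `sqrt_nu_timeLag` = `IntegratedStretch.sqrt_nu_timeLag`, `continuous_maxRdnu` = `IntegratedStretch.continuous_maxRdnu`, `sing_of_not_bounded` = `InviscidTop.sing_of_not_bounded`, `nonIntensifying_ancient_trivial` = `eq_zero_of_nonIntensifying`, `vort_eq` = `FrozenTop.freeze_eq`, `exists_singularZoom_package₃` = `FrozenTop.exists_singularZoom_package₃`, `lapD_eq_zero_of_eq_zero`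 = `FrozenTop.lapD_eq_zero_of_eq_zero`.
-/

-- the summit and its single problem share the name `NavierStokesRegularity` (D-0017 nested layout)
set_option linter.dupNamespace false

noncomputable section

open MeasureTheory Set Function Filter TopologicalSpace Metric
open scoped Topology NNReal ENNReal InnerProductSpace RealInnerProductSpace Laplacian

namespace Summit.NavierStokesRegularity.NavierStokesRegularity.Theorems.ScenarioCensus.IntegratedQuench

open Literature.Analysis Literature.Analysis.FluidPDE
open Summit.NavierStokesRegularity.NavierStokesRegularity.Theorems

/-! ## The cut-off enstrophy `Φ(σ) = ∫ |ω(σ, y)|² χ(σ, y) dy` is non-increasing -/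

/-- The cut-off enstrophy around `y₀`. -/
def Phi (C : ℝ) (W : ℝ → E3 → E3) (y₀ : E3) (σ : ℝ) : ℝ := ∫ y, ‖curl (W σ) y‖ ^ 2 * chi C y₀ σ y

/-- `0 ≤ Φ`. -/
theorem Phi_nonneg (C : ℝ) (W : ℝ → E3 → E3) (y₀ : E3) (σ : ℝ) : 0 ≤ Phi C W y₀ σ :=
  integral_nonneg fun y => mul_nonneg (sq_nonneg _) (chi_nonneg C y₀ σ y)

/-- The integrand of `Φ` is continuous. -/
theorem continuous_integrand {C : ℝ} {W : ℝ → E3 → E3} (hW : IsTypeIAncientMild C W) (y₀ : E3) {σ : ℝ} (hσ : σ < 0) :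
    Continuous fun y => ‖curl (W σ) y‖ ^ 2 * chi C y₀ σ y :=
  (((contDiff_two_curl_slice hW hσ).continuous.norm).pow 2).mul (continuous_chi C y₀ σ)

/-- The integrand of `Φ` is integrable. -/
theorem integrable_integrand {C : ℝ} {W : ℝ → E3 → E3} (hW : IsTypeIAncientMild C W) (y₀ : E3) {σ : ℝ} (hσ : σ < 0) :
    Integrable fun y => ‖curl (W σ) y‖ ^ 2 * chi C y₀ σ y :=
  (continuous_integrand hW y₀ hσ).integrable_of_hasCompactSupport (hasCompactSupport_chi hW.nonneg y₀ σ).mul_left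

/-- **The sign of the drift term.** On the support of `ψ'(a q)` (where `q = ‖y − y₀‖² ≥ Rad²`) the transport
`a · 2⟪y − y₀, W⟫` is dominated by the shrinking rate `a' q`, because `‖W‖ ≤ C/√(−σ)`; with `ψ' ≤ 0` the product is
`≤ 0`. -/
theorem drift_term_nonpos {C : ℝ} {W : ℝ → E3 → E3} (hW : IsTypeIAncientMild C W) (y₀ : E3) {σ : ℝ} (hσ : σ < 0)
    (y : E3) :
    deriv ψ (aW C σ * ‖y - y₀‖ ^ 2) * (aW C σ * (2 * ⟪y - y₀, W σ y⟫) + aW' C σ * ‖y - y₀‖ ^ 2) ≤ 0 := by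
  have hC := hW.nonneg
  by_cases hq : aW C σ * ‖y - y₀‖ ^ 2 < 1
  · rw [deriv_ψ_eq_zero_of_lt_one hq, zero_mul]
  refine mul_nonpos_iff.2 (Or.inr ⟨deriv_ψ_nonpos _, ?_⟩)
  have hR := Rad_pos hC σ
  have hs : 0 < Real.sqrt (-σ) := Real.sqrt_pos.2 (by linarith)
  have hr0 : 0 ≤ ‖y - y₀‖ := norm_nonneg _
  have hq' : Rad C σ ^ 2 ≤ ‖y - y₀‖ ^ 2 := by
    rw [not_lt, aW, inv_mul_eq_div, le_div_iff₀ (pow_pos hR 2), one_mul] at hq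
    exact hq
  have hrR : Rad C σ ≤ ‖y - y₀‖ := by nlinarith
  have hWy : ‖W σ y‖ ≤ C / Real.sqrt (-σ) := hW.norm_le hσ y
  have hinner : -(‖y - y₀‖ * (C / Real.sqrt (-σ))) ≤ ⟪y - y₀, W σ y⟫ := by
    have h1 := (abs_le.1 (abs_real_inner_le_norm (y - y₀) (W σ y))).1
    have h2 : ‖y - y₀‖ * ‖W σ y‖ ≤ ‖y - y₀‖ * (C / Real.sqrt (-σ)) := mul_le_mul_of_nonneg_left hWy hr0
    linarith
  have key : aW C σ * (2 * -(‖y - y₀‖ * (C / Real.sqrt (-σ)))) + aW' C σ * ‖y - y₀‖ ^ 2 ≤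
      aW C σ * (2 * ⟪y - y₀, W σ y⟫) + aW' C σ * ‖y - y₀‖ ^ 2 := by
    have := aW_pos hC σ
    nlinarith
  refine le_trans ?_ key
  have e : aW C σ * (2 * -(‖y - y₀‖ * (C / Real.sqrt (-σ)))) + aW' C σ * ‖y - y₀‖ ^ 2 =
      2 * C * ‖y - y₀‖ * (‖y - y₀‖ - Rad C σ) / (Real.sqrt (-σ) * Rad C σ ^ 3) := by
    rw [aW, aW']
    field_simp
    ring
  rw [e]
  exact div_nonneg (mul_nonneg (by positivity) (by linarith)) (by positivity)

/-- **Monotonicity of the cut-off enstrophy.** Under the non-intensification hypothesis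
`⟪ω, Δω + (ω·∇)W⟫ ≤ 0`, `Φ` is differentiable on `(−∞, 0)` with derivative `≤ 0`. -/
theorem Phi_deriv {C : ℝ} {W : ℝ → E3 → E3} (hW : IsTypeIAncientMild C W)
    (h : ∀ s < (0 : ℝ), ∀ y : E3, ⟪curl (W s) y, (Δ (curl (W s))) y + convect (curl (W s)) (W s) y⟫ ≤ 0)
    (y₀ : E3) {σ₀ : ℝ} (hσ₀ : σ₀ < 0) :
    ∃ D ≤ (0 : ℝ), HasDerivAt (Phi C W y₀) D σ₀ := by
  have hC := hW.nonneg
  obtain ⟨B, hB0, hB⟩ := exists_bounds C hσ₀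
  obtain ⟨S, hS0, hS⟩ := exists_abs_deriv_ψ_le
  -- the window
  have hs : Ioo (2 * σ₀) (σ₀ / 2) ∈ 𝓝 σ₀ := Ioo_mem_nhds (by linarith) (by linarith)
  have hsneg : ∀ σ ∈ Ioo (2 * σ₀) (σ₀ / 2), σ < 0 := fun σ hσ => by linarith [hσ.2]
  have hRle : ∀ σ ∈ Ioo (2 * σ₀) (σ₀ / 2), Rad C σ ≤ Rad C (2 * σ₀) := fun σ hσ => Rad_mono hC hσ.1.le
  have hsq0 : 0 < Real.sqrt (-(σ₀ / 2)) := Real.sqrt_pos.2 (by linarith)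
  have haW' : ∀ σ ∈ Ioo (2 * σ₀) (σ₀ / 2), aW' C σ ≤ 2 * C / Real.sqrt (-(σ₀ / 2)) := by
    intro σ hσ
    have hR1 := one_le_Rad hC σ
    have hsσ : 0 < Real.sqrt (-σ) := Real.sqrt_pos.2 (by linarith [hσ.2])
    have hsq : Real.sqrt (-(σ₀ / 2)) ≤ Real.sqrt (-σ) := Real.sqrt_le_sqrt (by linarith [hσ.2])
    have hR3 : 1 ≤ Rad C σ ^ 3 := one_le_pow₀ hR1
    rw [aW', div_le_div_iff₀ (mul_pos hsσ (by positivity)) hsq0]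
    have : Real.sqrt (-(σ₀ / 2)) ≤ Real.sqrt (-σ) * Rad C σ ^ 3 := by nlinarith
    nlinarith
  -- names for the radius of the support, the dominating constant, the integrands
  obtain ⟨ρ, hρ⟩ : ∃ ρ : ℝ, ρ = Real.sqrt 2 * Rad C (2 * σ₀) := ⟨_, rfl⟩
  obtain ⟨M, hM⟩ : ∃ M : ℝ, M = 2 * B * B + B ^ 2 * (S * (2 * C / Real.sqrt (-(σ₀ / 2)) * ρ ^ 2)) := ⟨_, rfl⟩
  obtain ⟨F, hF⟩ : ∃ F : ℝ → E3 → ℝ, F = fun σ y => ‖curl (W σ) y‖ ^ 2 * chi C y₀ σ y := ⟨_, rfl⟩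
  obtain ⟨F', hF'⟩ : ∃ F' : ℝ → E3 → ℝ, F' = fun σ y => 2 * ⟪curl (W σ) y, vdot W σ y⟫ * chi C y₀ σ y +
      ‖curl (W σ) y‖ ^ 2 * (deriv ψ (aW C σ * ‖y - y₀‖ ^ 2) * (aW' C σ * ‖y - y₀‖ ^ 2)) := ⟨_, rfl⟩
  -- vanishing outside the ball `closedBall y₀ ρ`, uniformly on the window
  have hout : ∀ σ ∈ Ioo (2 * σ₀) (σ₀ / 2), ∀ y ∉ closedBall y₀ ρ,
      chi C y₀ σ y = 0 ∧ deriv ψ (aW C σ * ‖y - y₀‖ ^ 2) = 0 := by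
    intro σ hσ y hy
    rw [mem_closedBall_iff_norm, not_le, hρ] at hy
    have hlt : Real.sqrt 2 * Rad C σ < ‖y - y₀‖ :=
      lt_of_le_of_lt (mul_le_mul_of_nonneg_left (hRle σ hσ) (Real.sqrt_nonneg 2)) hy
    exact ⟨chi_eq_zero hC hlt, deriv_ψ_aW_eq_zero hC hlt⟩
  -- pointwise differentiability in `σ`
  have hdiff : ∀ y, ∀ σ ∈ Ioo (2 * σ₀) (σ₀ / 2), HasDerivAt (fun σ => F σ y) (F' σ y) σ := by
    intro y σ hσ
    rw [hF, hF']
    exact (hasDerivAt_curl hW (hsneg σ hσ) y).norm_sq.mul (hasDerivAt_chi hC (hsneg σ hσ) y₀ y)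
  -- domination
  have hbound : ∀ y, ∀ σ ∈ Ioo (2 * σ₀) (σ₀ / 2), ‖F' σ y‖ ≤ (closedBall y₀ ρ).indicator (fun _ => M) y := by
    intro y σ hσ
    by_cases hy : y ∈ closedBall y₀ ρ
    · rw [indicator_of_mem hy, hM, hF', Real.norm_eq_abs]
      obtain ⟨hWb, hωb, -, hvb⟩ := hB hW σ hσ y
      have hq : ‖y - y₀‖ ^ 2 ≤ ρ ^ 2 := by
        rw [mem_closedBall_iff_norm] at hy
        exact pow_le_pow_left₀ (norm_nonneg _) hy 2
      have t1 : |2 * ⟪curl (W σ) y, vdot W σ y⟫ * chi C y₀ σ y| ≤ 2 * B * B := by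
        rw [abs_mul, abs_mul, abs_of_nonneg (chi_nonneg C y₀ σ y), abs_two]
        have hi : |⟪curl (W σ) y, vdot W σ y⟫| ≤ B * B :=
          (abs_real_inner_le_norm _ _).trans (mul_le_mul hωb hvb (norm_nonneg _) hB0)
        have hc1 := chi_le_one C y₀ σ y
        have : 0 ≤ |⟪curl (W σ) y, vdot W σ y⟫| := abs_nonneg _
        nlinarith
      have t2 : |‖curl (W σ) y‖ ^ 2 * (deriv ψ (aW C σ * ‖y - y₀‖ ^ 2) * (aW' C σ * ‖y - y₀‖ ^ 2))| ≤
          B ^ 2 * (S * (2 * C / Real.sqrt (-(σ₀ / 2)) * ρ ^ 2)) := by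
        rw [abs_mul, abs_mul, abs_mul, abs_of_nonneg (sq_nonneg ‖curl (W σ) y‖), abs_of_nonneg (aW'_nonneg hC σ),
          abs_of_nonneg (sq_nonneg ‖y - y₀‖)]
        have e1 : ‖curl (W σ) y‖ ^ 2 ≤ B ^ 2 := pow_le_pow_left₀ (norm_nonneg _) hωb 2
        have e2 := hS (aW C σ * ‖y - y₀‖ ^ 2)
        have e3 := haW' σ hσ
        have e4 := aW'_nonneg hC σ
        gcongr
      exact (abs_add_le _ _).trans (add_le_add t1 t2)
    · rw [indicator_of_notMem hy, hF']
      obtain ⟨hχ0, hψ0⟩ := hout σ hσ y hy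
      simp [hχ0, hψ0]
  -- measurability / integrability inputs
  have hF_meas : ∀ᶠ σ in 𝓝 σ₀, AEStronglyMeasurable (F σ) volume := by
    filter_upwards [hs] with σ hσ
    rw [hF]
    exact (continuous_integrand hW y₀ (hsneg σ hσ)).aestronglyMeasurable
  have hF_int : Integrable (F σ₀) volume := by
    rw [hF]; exact integrable_integrand hW y₀ hσ₀
  have hF'_cont : Continuous (F' σ₀) := by
    rw [hF']
    have hω := (contDiff_two_curl_slice hW hσ₀).continuous
    refine ((continuous_const.mul (hω.inner (continuous_vdot hW hσ₀))).mul (continuous_chi C y₀ σ₀)).add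
      ((hω.norm.pow 2).mul ((continuous_deriv_ψ.comp (continuous_const.mul
        ((continuous_id.sub continuous_const).norm.pow 2))).mul
        (continuous_const.mul ((continuous_id.sub continuous_const).norm.pow 2))))
  have hbi : Integrable ((closedBall y₀ ρ).indicator fun _ => M) volume :=
    (integrableOn_const (measure_closedBall_lt_top (x := y₀) (r := ρ)).ne).integrable_indicator
      measurableSet_closedBall
  obtain ⟨hF'int, hD⟩ := hasDerivAt_integral_of_dominated_loc_of_deriv_le hs hF_meas hF_int
    hF'_cont.aestronglyMeasurable (Eventually.of_forall fun y σ hσ => hbound y σ hσ) hbi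
    (Eventually.of_forall fun y σ hσ => hdiff y σ hσ)
  refine ⟨∫ y, F' σ₀ y, ?_, by rw [show Phi C W y₀ = fun σ => ∫ y, F σ y from funext fun σ => by rw [Phi, hF]]; exact hD⟩
  /- ### the sign of `∫ F'(σ₀, y) dy`
    `F' = G₁ + P − I` with `G₁ = 2⟪ω, Δω + (ω·∇)W⟫χ ≤ 0`, `P = |ω|² ψ'(aq)(a·2⟪y − y₀, W⟫ + a'q) ≤ 0` (drift lemma) and
    `I = ⟪W, ∇(|ω|²χ)⟫`, whose integral vanishes (`div W = 0`, integration by parts). -/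
  have hC3 := contDiff_three_slice hW hσ₀
  have hω2 := contDiff_two_curl_slice hW hσ₀
  have hω1 : ContDiff ℝ 1 (curl (W σ₀)) := hω2.of_le (by norm_cast)
  have hW1 : ContDiff ℝ 1 (W σ₀) := (hW.contDiff_slice hσ₀).of_le (by norm_cast)
  have hθ1 : ContDiff ℝ 1 (fun y => ‖curl (W σ₀) y‖ ^ 2) := hω1.norm_sq ℝ
  have hχ1 : ContDiff ℝ 1 (chi C y₀ σ₀) := contDiff_chi C y₀ σ₀
  have hΘ1 : ContDiff ℝ 1 (fun y => ‖curl (W σ₀) y‖ ^ 2 * chi C y₀ σ₀ y) := hθ1.mul hχ1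
  have hΘc : HasCompactSupport (fun y => ‖curl (W σ₀) y‖ ^ 2 * chi C y₀ σ₀ y) :=
    (hasCompactSupport_chi hC y₀ σ₀).mul_left
  have hibp := integral_mul_divergence_add_eq_zero_left hΘ1 hW1 hΘc
  have hdiv0 : (∫ y, (‖curl (W σ₀) y‖ ^ 2 * chi C y₀ σ₀ y) * VectorCalculus.divergence (W σ₀) y) = 0 := by
    simp [hW.isDivFree hσ₀ _]
  rw [hdiv0, zero_add] at hibp
  -- the integrand of the IBP identity, computed
  have hgrad : ∀ y, ⟪W σ₀ y, gradient (fun y => ‖curl (W σ₀) y‖ ^ 2 * chi C y₀ σ₀ y) y⟫ =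
      2 * ⟪curl (W σ₀) y, fderiv ℝ (curl (W σ₀)) y (W σ₀ y)⟫ * chi C y₀ σ₀ y +
      ‖curl (W σ₀) y‖ ^ 2 * (deriv ψ (aW C σ₀ * ‖y - y₀‖ ^ 2) * (aW C σ₀ * (2 * ⟪y - y₀, W σ₀ y⟫))) := by
    intro y
    rw [real_inner_comm, gradient, InnerProductSpace.toDual_symm_apply]
    have hdθ : HasFDerivAt (fun y => ‖curl (W σ₀) y‖ ^ 2)
        (2 • (innerSL ℝ (curl (W σ₀) y)).comp (fderiv ℝ (curl (W σ₀)) y)) y :=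
      ((hω1.differentiable (by simp)) y).hasFDerivAt.norm_sq
    have hdχ : HasFDerivAt (chi C y₀ σ₀) (fderiv ℝ (chi C y₀ σ₀) y) y :=
      ((hχ1.differentiable (by simp)) y).hasFDerivAt
    rw [show (fun y => ‖curl (W σ₀) y‖ ^ 2 * chi C y₀ σ₀ y) = (fun y => ‖curl (W σ₀) y‖ ^ 2) * chi C y₀ σ₀
      from rfl, (hdθ.mul hdχ).fderiv]
    simp only [_root_.add_apply, _root_.smul_apply, smul_eq_mul,
      ContinuousLinearMap.comp_apply, innerSL_apply_apply, fderiv_chi_apply, nsmul_eq_mul, Nat.cast_ofNat]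
    ring
  rw [show (fun y => ⟪W σ₀ y, gradient (fun y => ‖curl (W σ₀) y‖ ^ 2 * chi C y₀ σ₀ y) y⟫) = fun y =>
      2 * ⟪curl (W σ₀) y, fderiv ℝ (curl (W σ₀)) y (W σ₀ y)⟫ * chi C y₀ σ₀ y +
      ‖curl (W σ₀) y‖ ^ 2 * (deriv ψ (aW C σ₀ * ‖y - y₀‖ ^ 2) * (aW C σ₀ * (2 * ⟪y - y₀, W σ₀ y⟫)))
      from funext hgrad] at hibp
  -- the three pieces
  obtain ⟨G₁, hG₁⟩ : ∃ G₁ : E3 → ℝ, G₁ = fun y =>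
      2 * ⟪curl (W σ₀) y, (Δ (curl (W σ₀))) y + convect (curl (W σ₀)) (W σ₀) y⟫ * chi C y₀ σ₀ y := ⟨_, rfl⟩
  obtain ⟨P, hP⟩ : ∃ P : E3 → ℝ, P = fun y => ‖curl (W σ₀) y‖ ^ 2 *
      (deriv ψ (aW C σ₀ * ‖y - y₀‖ ^ 2) * (aW C σ₀ * (2 * ⟪y - y₀, W σ₀ y⟫) + aW' C σ₀ * ‖y - y₀‖ ^ 2)) := ⟨_, rfl⟩
  obtain ⟨I, hI⟩ : ∃ I : E3 → ℝ, I = fun y => 2 * ⟪curl (W σ₀) y, fderiv ℝ (curl (W σ₀)) y (W σ₀ y)⟫ * chi C y₀ σ₀ y +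
      ‖curl (W σ₀) y‖ ^ 2 * (deriv ψ (aW C σ₀ * ‖y - y₀‖ ^ 2) * (aW C σ₀ * (2 * ⟪y - y₀, W σ₀ y⟫))) := ⟨_, rfl⟩
  rw [← hI] at hibp
  have hsplit : F' σ₀ = fun y => G₁ y + P y - I y := by
    rw [hF', hG₁, hP, hI]
    funext y
    simp only [vdot, convect, inner_add_right, inner_sub_right]
    ring
  -- supports and integrability of the pieces
  have hR := Rad_pos hC σ₀
  have hvan : ∀ y ∉ closedBall y₀ (Real.sqrt 2 * Rad C σ₀),
      chi C y₀ σ₀ y = 0 ∧ deriv ψ (aW C σ₀ * ‖y - y₀‖ ^ 2) = 0 := by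
    intro y hy
    rw [mem_closedBall_iff_norm, not_le] at hy
    exact ⟨chi_eq_zero hC hy, deriv_ψ_aW_eq_zero hC hy⟩
  have hωc := hω2.continuous
  have hWc := (hW.contDiff_slice hσ₀).continuous
  have hqc : Continuous fun y : E3 => ‖y - y₀‖ ^ 2 := (continuous_id.sub continuous_const).norm.pow 2
  have hψ'c : Continuous fun y : E3 => deriv ψ (aW C σ₀ * ‖y - y₀‖ ^ 2) :=
    continuous_deriv_ψ.comp (continuous_const.mul hqc)
  have hG₁i : Integrable G₁ volume := by
    rw [hG₁]
    refine Continuous.integrable_of_hasCompactSupport ?_ ?_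
    · exact (continuous_const.mul (hωc.inner ((continuous_laplacian hω2).add
        (((hW.contDiff_slice hσ₀).continuous_fderiv (by simp)).clm_apply hωc)))).mul (continuous_chi C y₀ σ₀)
    · exact HasCompactSupport.intro (isCompact_closedBall y₀ (Real.sqrt 2 * Rad C σ₀)) fun y hy => by simp [(hvan y hy).1]
  have hPi : Integrable P volume := by
    rw [hP]
    refine Continuous.integrable_of_hasCompactSupport ?_ ?_
    · exact (hωc.norm.pow 2).mul (hψ'c.mul ((continuous_const.mul (continuous_const.mul
        ((continuous_id.sub continuous_const).inner hWc))).add (continuous_const.mul hqc)))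
    · exact HasCompactSupport.intro (isCompact_closedBall y₀ (Real.sqrt 2 * Rad C σ₀)) fun y hy => by simp [(hvan y hy).2]
  have hIi : Integrable I volume := by
    rw [hI]
    refine Continuous.integrable_of_hasCompactSupport ?_ ?_
    · exact ((continuous_const.mul (hωc.inner ((hω2.continuous_fderiv (by simp)).clm_apply hWc))).mul
        (continuous_chi C y₀ σ₀)).add ((hωc.norm.pow 2).mul (hψ'c.mul (continuous_const.mul
        (continuous_const.mul ((continuous_id.sub continuous_const).inner hWc)))))
    · exact HasCompactSupport.intro (isCompact_closedBall y₀ (Real.sqrt 2 * Rad C σ₀)) fun y hy => by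
        simp [(hvan y hy).1, (hvan y hy).2]
  have hGP : Integrable (fun y => G₁ y + P y) volume := hG₁i.add hPi
  rw [hsplit, integral_sub hGP hIi, integral_add hG₁i hPi, hibp, sub_zero]
  have h1 : ∫ y, G₁ y ≤ 0 := by
    refine integral_nonpos fun y => ?_
    rw [hG₁]
    exact mul_nonpos_iff.2 (Or.inr ⟨by nlinarith [h σ₀ hσ₀ y], chi_nonneg C y₀ σ₀ y⟩)
  have h2 : ∫ y, P y ≤ 0 := by
    refine integral_nonpos fun y => ?_
    rw [hP]
    exact mul_nonpos_iff.2 (Or.inl ⟨sq_nonneg _, drift_term_nonpos hW y₀ hσ₀ y⟩)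
  linarith

/-- `Φ` is non-increasing on `(-∞, 0)`. -/
theorem antitoneOn_Phi {C : ℝ} {W : ℝ → E3 → E3} (hW : IsTypeIAncientMild C W)
    (h : ∀ s < (0 : ℝ), ∀ y : E3, ⟪curl (W s) y, (Δ (curl (W s))) y + convect (curl (W s)) (W s) y⟫ ≤ 0)
    (y₀ : E3) : AntitoneOn (Phi C W y₀) (Iio 0) := by
  apply antitoneOn_of_deriv_nonpos (convex_Iio 0)
  · intro σ hσ
    obtain ⟨D, -, hD⟩ := Phi_deriv hW h y₀ hσ
    exact hD.continuousAt.continuousWithinAt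
  · rw [interior_Iio]
    intro σ hσ
    obtain ⟨D, -, hD⟩ := Phi_deriv hW h y₀ hσ
    exact hD.differentiableAt.differentiableWithinAt
  · rw [interior_Iio]
    intro σ hσ
    obtain ⟨D, hD0, hD⟩ := Phi_deriv hW h y₀ hσ
    rw [hD.deriv]
    exact hD0

end Summit.NavierStokesRegularity.NavierStokesRegularity.Theorems.ScenarioCensus.IntegratedQuench

end
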